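import Literature.Analysis.DeBrangesSpaces.SonineMellinEntire
import Literature.NumberTheory.LFunctions.BurnolZetaSystemsProofs
import HarnessLib

/-!
# De Branges' theorem (Burnol 2004, Thm. 2.1): the completed Mellin transforms of `K_a` are entire and the
# evaluations are continuous — DISCHARGE of `Burnol2004b_thm2_1`

LINE 1 — LABEL: RH-FREE (an unconditional theorem of analysis about the Sonine spaces `K_a`; the zeros of
`ζ` do not occur). FRAMING (cell rh-crit, D-0074): corpus theorems are RH-FREE literature; nothing here is
worded as progress toward RH. bears_on: B-C/B-P (LADDER-RH COLUMN 6, de Branges framework): this is the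
existence theorem behind the evaluators `Z^a_{w,k}`, `Y^a_{w,k}` of Burnol's two systems
(`BurnolZetaSystems.lean`). WHAT THIS IS NOT: not a route, not a criterion for RH; discharging de Branges'
1964 theorem fixes the vocabulary of a corpus, it does not move RH. Nothing here bears on the truth of RH.

Sources: J.-F. Burnol, *Two complete and minimal systems associated with the zeros of the Riemann zeta
function*, J. Théor. Nombres Bordeaux 16 (2004) 65–94 = arXiv:math/0203120v7, Thm. 2.1 (TeX l.437–443:
"We gave an elementary proof of this statement in [Burnol2001CRAS]"); L. de Branges, *Self-reciprocal
functions*, J. Math. Anal. Appl. 9 (1964) 433–457 [deBranges1964]; the elementary proof formalised in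
`Literature/Analysis/DeBrangesSpaces/SonineMellinEntire.lean` (Burnol 2001, eq. (1.2)).

PROVED here: `Burnol2004b_thm2_1_holds : Burnol2004b_thm2_1` (both clauses, as typed in
`BurnolZetaSystems.lean`), through the dictionary `rightMellin f s = mellin f (1 − s)`, `K_a = S(a,a)`
(`sonineK_eq_soninSpace`), and `G(s) := SonineMellin.sonineMellinExt a a (𝓕 f) (1 − s)`. No definitions,
no new named facts.
-/

noncomputable section

open _root_.MeasureTheory _root_.Complex _root_.Filter _root_.Set FourierTransform
open scoped Topology Real
open Literature.NumberTheory.ConnesConsani2021 (soninSpace)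
open Literature.Analysis.DeBrangesSpaces.SonineMellin

namespace Literature.NumberTheory.LFunctions

/-- `Γ_ℝ(s) = π^{-s/2}Γ(s/2)` is differentiable wherever it does not vanish, i.e. off its poles `0, −2, −4, …`
(from the entire function `1/Γ_ℝ`). [folklore] -/
private theorem differentiableAt_Gammaℝ {s : ℂ} (hs : Gammaℝ s ≠ 0) : DifferentiableAt ℂ Gammaℝ s := by
  have h := (differentiable_Gammaℝ_inv s).inv (inv_ne_zero hs)
  refine h.congr_of_eventuallyEq (Eventually.of_forall fun z ↦ ?_)
  simp

/-- The pole-free set `{s | Γ_ℝ(s) ≠ 0} = ℂ ∖ {0, −2, −4, …}` is preconnected (complement of a countable set in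
the plane). [folklore] -/
private theorem isPreconnected_Gammaℝ_ne_zero : IsPreconnected {s : ℂ | Gammaℝ s ≠ 0} := by
  have hS : {s : ℂ | Gammaℝ s ≠ 0} = (Set.range (fun n : ℕ ↦ -(2 * (n : ℂ))))ᶜ := by
    ext s
    simp only [mem_setOf_eq, mem_compl_iff, mem_range, ne_eq, Gammaℝ_eq_zero_iff, not_exists]
    constructor
    · intro h n hn; exact h n hn.symm
    · intro h n hn; exact h n hn.symm
  rw [hS]
  exact ((Set.countable_range _).isPathConnected_compl_of_one_lt_rank (by simp)).isConnected
    |>.isPreconnected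

/-- **Thm. 2.1 holds (de Branges 1964, Burnol's elementary proof)**. For `0 < a` and `f ∈ K_a`:
(i) the right Mellin transform `f̂(s) = ∫_0^∞ f(t)t^{−s}dt` (absolutely convergent on `Re s > 1/2`) has the
ENTIRE continuation `G(s) = ∫_a^∞ 𝓕f(u)·C_a(u,1−s)du`, which vanishes at `s = 0, −2, −4, …` (the trivial
zeros, where the poles of `Γ_ℝ` sit, so that `M(f) = Γ_ℝ·G` is entire); (ii) for every `w ∈ ℂ` there is
`C_w` with `‖M(w)‖ ≤ C_w‖f‖` for every `f ∈ K_a` and every entire `M` agreeing with `Γ_ℝ(s)f̂(s)` on the strip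
`1/2 < Re s < 1`: off the poles `M = Γ_ℝ·G` by the identity theorem on the (connected) pole-free set and
`‖G(1−w)‖ ≤ C(a,R)‖𝓕f‖ = C(a,R)‖f‖` (Plancherel); AT a pole `w = −2n` the unit circle around `w` avoids the
other poles and the maximum modulus principle bounds `M(w)` by the same kind of constant. "The evaluations
at complex numbers `w ∈ ℂ` are continuous linear forms on `K_a`."
[cite: Burnol2004b, Thm. 2.1 (arXiv:math/0203120v7 p. 5, TeX l.437–443); Burnol2001CRAS, Théorème 1.1 and eq. (1.2); deBranges1964] -/
theorem Burnol2004b_thm2_1_holds : Burnol2004b_thm2_1 := by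
  intro a ha
  -- the continuation, for `f ∈ K_a = S(a,a)`
  have hmem : ∀ f ∈ sonineK a, f ∈ soninSpace a a := by
    intro f hf
    rw [sonineK_eq_soninSpace] at hf
    exact hf
  have key : ∀ f ∈ sonineK a,
      Differentiable ℂ (fun s ↦ sonineMellinExt a a ((𝓕 f : Lp ℂ 2 (volume : Measure ℝ)) : ℝ → ℂ)
        (1 - s)) ∧
      (∀ n : ℕ, sonineMellinExt a a ((𝓕 f : Lp ℂ 2 (volume : Measure ℝ)) : ℝ → ℂ)
        (1 - (-2 * (n : ℂ))) = 0) ∧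
      (∀ s : ℂ, 1 / 2 < s.re →
        sonineMellinExt a a ((𝓕 f : Lp ℂ 2 (volume : Measure ℝ)) : ℝ → ℂ) (1 - s) =
          rightMellin f s) := by
    intro f hf
    obtain ⟨heven, hfa, hFb⟩ := hmem f hf
    refine ⟨(differentiable_sonineMellinExt ha ha _).comp
      ((differentiable_const _).sub differentiable_id), fun n ↦ ?_, fun s hs ↦ ?_⟩
    · rw [show (1 : ℂ) - -2 * (n : ℂ) = 1 + 2 * n by ring]
      exact sonineMellinExt_one_add_two_mul ha ha f heven hfa hFb n
    · rw [rightMellin]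
      exact sonineMellinExt_eq_mellin ha ha f heven hfa hFb (by simp; linarith)
  refine ⟨fun f hf ↦ ⟨_, (key f hf).1, (key f hf).2.1, fun s hs _ ↦ (key f hf).2.2 s hs⟩,
    fun w ↦ ?_⟩
  -- (ii): any entire `M` agreeing with `Γ_ℝ · f̂` on the strip is `Γ_ℝ · G_f` off the poles
  set P : Set ℂ := {s | Gammaℝ s ≠ 0} with hP
  have hPo : IsOpen P := by
    have : P = (fun s ↦ (Gammaℝ s)⁻¹) ⁻¹' {z | z ≠ 0} := by
      ext s; simp [hP]
    rw [this]
    exact isOpen_ne.preimage differentiable_Gammaℝ_inv.continuous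
  have hident : ∀ f ∈ sonineK a, ∀ M : ℂ → ℂ, Differentiable ℂ M →
      (∀ s : ℂ, 1 / 2 < s.re → s.re < 1 → M s = Gammaℝ s * rightMellin f s) →
      ∀ z : ℂ, Gammaℝ z ≠ 0 →
        M z = Gammaℝ z * sonineMellinExt a a ((𝓕 f : Lp ℂ 2 (volume : Measure ℝ)) : ℝ → ℂ)
          (1 - z) := by
    intro f hf M hM hstrip z hz
    obtain ⟨hSd, -, hSeq⟩ := key f hf
    have h1 : AnalyticOnNhd ℂ M P := hM.differentiableOn.analyticOnNhd hPo
    have h2 : AnalyticOnNhd ℂ (fun z ↦ Gammaℝ z *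
        sonineMellinExt a a ((𝓕 f : Lp ℂ 2 (volume : Measure ℝ)) : ℝ → ℂ) (1 - z)) P := by
      refine DifferentiableOn.analyticOnNhd (fun z hz ↦ ?_) hPo
      exact ((differentiableAt_Gammaℝ hz).mul (hSd z)).differentiableWithinAt
    have hz₀ : (3 / 4 : ℂ) ∈ P := by
      simp only [hP, mem_setOf_eq]
      exact Gammaℝ_ne_zero_of_re_pos (by norm_num)
    have hstripo : IsOpen {s : ℂ | 1 / 2 < s.re ∧ s.re < 1} :=
      (isOpen_lt continuous_const Complex.continuous_re).inter
        (isOpen_lt Complex.continuous_re continuous_const)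
    have hev : M =ᶠ[𝓝 (3 / 4 : ℂ)] fun z ↦ Gammaℝ z *
        sonineMellinExt a a ((𝓕 f : Lp ℂ 2 (volume : Measure ℝ)) : ℝ → ℂ) (1 - z) := by
      filter_upwards [hstripo.mem_nhds (by simp only [mem_setOf_eq]; norm_num :
        (3 / 4 : ℂ) ∈ {s : ℂ | 1 / 2 < s.re ∧ s.re < 1})] with s hs
      rw [hstrip s hs.1 hs.2, hSeq s hs.1]
    exact h1.eqOn_of_preconnected_of_eventuallyEq h2 isPreconnected_Gammaℝ_ne_zero hz₀ hev hz
  have hnorm1w : ∀ z : ℂ, ‖1 - z‖ ≤ ‖z‖ + 1 := fun z ↦ by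
    calc ‖1 - z‖ ≤ ‖(1 : ℂ)‖ + ‖z‖ := norm_sub_le _ _
      _ = ‖z‖ + 1 := by simp [add_comm]
  by_cases hw : Gammaℝ w ≠ 0
  · obtain ⟨C₁, hC₁0, hC₁⟩ := exists_bound_sonineMellinExt ha ha (‖w‖ + 1)
    refine ⟨‖Gammaℝ w‖ * C₁, fun f hf M hM hstrip ↦ ?_⟩
    rw [hident f hf M hM hstrip w hw, norm_mul, mul_assoc]
    refine mul_le_mul_of_nonneg_left ?_ (norm_nonneg (Gammaℝ w))
    calc ‖sonineMellinExt a a ((𝓕 f : Lp ℂ 2 (volume : Measure ℝ)) : ℝ → ℂ) (1 - w)‖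
        ≤ C₁ * ‖(𝓕 f : Lp ℂ 2 (volume : Measure ℝ))‖ := hC₁ _ _ (hnorm1w w)
      _ = C₁ * ‖f‖ := by rw [Lp.norm_fourier_eq]
  · push Not at hw
    -- `w = -2n₀`: maximum modulus on the unit disc around `w`, whose boundary avoids the poles
    have hsphere : ∀ z ∈ Metric.sphere w 1, Gammaℝ z ≠ 0 := by
      intro z hz hz0
      obtain ⟨n, hn⟩ := Gammaℝ_eq_zero_iff.mp hw
      obtain ⟨m, hm⟩ := Gammaℝ_eq_zero_iff.mp hz0
      rw [Metric.mem_sphere, dist_eq_norm, hn, hm,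
        show (-(2 * (m : ℂ)) - -(2 * (n : ℂ))) = (((2 * ((n : ℤ) - m) : ℤ)) : ℂ) by push_cast; ring,
        Complex.norm_intCast] at hz
      have h2 : |(2 * ((n : ℤ) - m) : ℤ)| = 1 := by exact_mod_cast hz
      rcases abs_eq (zero_le_one' ℤ) |>.mp h2 with h | h <;> omega
    have hcont : ContinuousOn Gammaℝ (Metric.sphere w 1) := fun z hz ↦
      (differentiableAt_Gammaℝ (hsphere z hz)).continuousAt.continuousWithinAt
    obtain ⟨B, hB⟩ := (isCompact_sphere w 1).exists_bound_of_continuousOn hcont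
    obtain ⟨C₂, hC₂0, hC₂⟩ := exists_bound_sonineMellinExt ha ha (‖w‖ + 2)
    refine ⟨max B 0 * C₂, fun f hf M hM hstrip ↦ ?_⟩
    refine Complex.norm_le_of_forall_mem_frontier_norm_le (U := Metric.ball w 1) Metric.isBounded_ball
      hM.diffContOnCl (fun z hz ↦ ?_) (subset_closure (Metric.mem_ball_self one_pos))
    rw [frontier_ball w one_ne_zero] at hz
    rw [hident f hf M hM hstrip z (hsphere z hz), norm_mul, mul_assoc]
    refine mul_le_mul ((hB z hz).trans (le_max_left _ _)) ?_ (norm_nonneg _) (le_max_right _ _)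
    have hz' : ‖1 - z‖ ≤ ‖w‖ + 2 := by
      have h1 : ‖z - w‖ = 1 := by rw [← dist_eq_norm]; exact hz
      calc ‖1 - z‖ ≤ ‖z‖ + 1 := hnorm1w z
        _ = ‖(z - w) + w‖ + 1 := by ring_nf
        _ ≤ (‖z - w‖ + ‖w‖) + 1 := by gcongr; exact norm_add_le _ _
        _ = ‖w‖ + 2 := by rw [h1]; ring
    calc ‖sonineMellinExt a a ((𝓕 f : Lp ℂ 2 (volume : Measure ℝ)) : ℝ → ℂ) (1 - z)‖
        ≤ C₂ * ‖(𝓕 f : Lp ℂ 2 (volume : Measure ℝ))‖ := hC₂ _ _ hz'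
      _ = C₂ * ‖f‖ := by rw [Lp.norm_fourier_eq]

end Literature.NumberTheory.LFunctions
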